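import Summits.AtomisticToContinuum.HydrodynamicLimit.Theorems.LambertianContactSwapContactAngleEquidistributionEqCentring
import Summits.AtomisticToContinuum.HydrodynamicLimit.Theorems.LambertianContactSwapContactAngleEquidistributionFibreAdmissible
import Summits.AtomisticToContinuum.HydrodynamicLimit.Theorems.LambertianContactSwapContactAngleEquidistributionNearFieldBall
import HarnessLib

/-!
# T1 at equilibrium: the near-field admissible-conditioned cosine law is EXACT for every `N`
# (stub `stub_nearFieldCosineEq`, line `Sketch`, skeleton v4, crux `LambertianContactSwap.ContactAngleEquidistribution`,
# stmt-AtomisticToContinuum-12097; lead `prover-line-stmt-AtomisticToContinuum-12097-c1-0`)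

WHAT. Thesis T1 of line `Sketch` ("near-field collisions have the cosine law CONDITIONED ON THE ADMISSIBLE
NORMALS of the actual environment") is an exact identity AT EQUILIBRIUM, for every `N`: under the homogeneous
Gibbs law `Q_N = localGibbsLaw σ 1 0 θe N (Φ N)` the mean of the NEAR-FIELD (a third centre within `3ε` of the
contact midpoint), speed-capped, `|g|²`-weighted contact-angle hit-sum of an admissible mark `ψ`, centred by the
cosine mean conditioned on the admissible normals `admissibleNormalsBall ε y i j x_mid`, is `0`
(`stub_nearFieldCosineEq`). Conditional on the named fact `HardSphereCampbellFormula` (CIP 1994 App. 4.A,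
pp. 107–111), like the whole equilibrium layer of the line.

HOW. It is the equilibrium centring principle `integral_hitSum_eq_zero_of_fibre` (tree file `…EqCentring`)
applied to the real mark
`F s y i j := [near y i j] [¬(V < |g|)] |g|² (ψ N s x_mid vᵢ vⱼ (ε⁻¹ sepVec) − admissibleCosineMean (adm y i j) g (ψ N s x_mid vᵢ vⱼ))`:
the mark is jointly measurable in `(s, y)` (NearField kit: `measurableSet_nearBall`,
`measurable_admissibleCosineMeanBall`, `measurable_psiAt`), bounded by `2V²` (`|ψ| ≤ 1`,
`|admissibleCosineMean| ≤ 1`, `|g| ≤ V` on the live branch), and its FIBRE HYPOTHESIS (equality of the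
midpoint-fibre cosine fluxes of `ρ_N F⁺` and `ρ_N F⁻`) is `stub_fibreAdmissible` (tree file `…FibreAdmissible`).
The proof is the ~40-line corollary pattern of `stub_costEqCentring`.

References: C. Cercignani, R. Illner, M. Pulvirenti, *The Mathematical Theory of Dilute Gases* (1994), App. 4.A
pp. 107–111, §4.2.
-/

noncomputable section

open MeasureTheory Filter Set Topology ProbabilityTheory
open scoped ENNReal BigOperators Classical RealInnerProductSpace

namespace Summit.AtomisticToContinuum.HydrodynamicLimit.Theorems.ContactAngleEquidistributionSketch

open Literature.Analysis.FluidPDE Literature.MathematicalPhysics.KineticTheory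

namespace EqCentring

/-- The near-field capped mark `[near] ([V < x] ? 0 : x² d)`, `|d| ≤ 2`, is bounded by `2V²`. [folklore]
-- adapted from `EqCentring.abs_ite_cap_le` (`…EqCentring`), the selector branches swapped -/
theorem abs_ite_ite_cap_le {p q : Prop} {ip : Decidable p} {iq : Decidable q} {x d V : ℝ} (hx : 0 ≤ x)
    (hq : ¬q → x ≤ V) (hd : |d| ≤ 2) : |@ite _ p ip (@ite _ q iq 0 (x ^ 2 * d)) 0| ≤ 2 * V ^ 2 := by
  by_cases hp : p
  · simp only [if_pos hp]
    by_cases hq' : q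
    · simp only [if_pos hq', abs_zero]; positivity
    · simp only [if_neg hq']
      rw [abs_mul, abs_pow, abs_of_nonneg hx, mul_comm 2 (V ^ 2)]
      exact mul_le_mul (pow_le_pow_left₀ hx (hq hq') 2) hd (abs_nonneg _) (sq_nonneg _)
  · simp only [if_neg hp, abs_zero]; positivity

end EqCentring

/-- **Registered sub-goal `stub_nearFieldCosineEq`** (line `Sketch` v4, crux ContactAngleEquidistribution,
stmt-AtomisticToContinuum-12097): T1 AT EQUILIBRIUM, EXACT FOR EVERY `N` — under the homogeneous Gibbs law
`Q_N` the mean of the near-field (midpoint-ball), capped, `|g|²`-weighted contact-angle hit-sum of an admissible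
mark `ψ` centred by its cosine mean CONDITIONED ON THE ADMISSIBLE NORMALS is `0` (conditional on
`HardSphereCampbellFormula`): the principle `integral_hitSum_eq_zero_of_fibre` for a jointly measurable mark
bounded by `2V²` whose fibre hypothesis is `stub_fibreAdmissible`. [cite: CIP1994, App. 4.A pp. 107–111] -/
theorem stub_nearFieldCosineEq (hC : HardSphereCampbellFormula) :
    let Cfg : ℕ → Type := fun N => Config (N + 1) (Fin 3) T3
    let G := Torus.geometry (Fin 3)
    let ε : ℝ → ℕ → ℝ := hsDiameter
    let τ : ℝ → (N : ℕ) → Cfg N → ℝ≥0∞ := fun σ N z => Alexander.freeExitTime G (ε σ N) z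
    let S : ℝ → (N : ℕ) → Cfg N → Cfg N := fun t _ z => freeFlight G t z
    let zpre : ℝ → (N : ℕ) → Cfg N → ℕ → Cfg N := fun σ N z m =>
      let y := Alexander.stateAfter G (ε σ N) z m; S (τ σ N y).toReal N y
    let Kt : ℝ → (N : ℕ) → Cfg N → ℝ → ℕ := fun σ N z t => Alexander.collisionCount G (ε σ N) z t
    let hit : ℝ → (N : ℕ) → Cfg N → Fin (N + 1) → Fin (N + 1) → Prop := fun σ N y i j =>
      i < j ∧ y ∈ contactSet G (N + 1) (ε σ N) i j ∧ IsIncoming G y i j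
    let tcol : ℝ → (N : ℕ) → Cfg N → ℕ → ℝ := fun σ N z m =>
      (Alexander.collisionInstant G (ε σ N) z (m + 1)).toReal
    let xmid : (N : ℕ) → Cfg N → Fin (N + 1) → Fin (N + 1) → T3 := fun _ y i j =>
      G.translate (y j).1 ((2 : ℝ)⁻¹ • G.sepVec (y i).1 (y j).1)
    let near : ℝ → (N : ℕ) → Cfg N → Fin (N + 1) → Fin (N + 1) → Prop := fun σ N y i j =>
      ∃ k : Fin (N + 1), k ≠ i ∧ k ≠ j ∧ ‖G.sepVec (y k).1 (xmid N y i j)‖ ≤ 3 * ε σ N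
    let adm : ℝ → (N : ℕ) → Cfg N → Fin (N + 1) → Fin (N + 1) → Set V3 := fun σ N y i j =>
      admissibleNormalsBall (ε σ N) y i j (xmid N y i j)
    ∀ θe : ℝ, 0 < θe → ∃ σ₀ : ℝ, 0 < σ₀ ∧ ∀ σ : ℝ, 0 < σ → σ < σ₀ →
      ∀ Φ : (N : ℕ) → HardSphereFlow G (ε σ N) (N + 1),
      let Q := fun N => localGibbsLaw σ (fun _ => 1) (fun _ => 0) (fun _ => θe) N (Φ N)
      ∀ t : ℝ, 0 ≤ t → ∀ V : ℝ, 0 < V →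
      ∀ ψ : ℕ → ℝ → T3 → V3 → V3 → V3 → ℝ,
        (∀ N, Measurable (fun p : ℝ × T3 × V3 × V3 × V3 =>
          ψ N p.1 p.2.1 p.2.2.1 p.2.2.2.1 p.2.2.2.2)) →
        (∀ N s x v w n, |ψ N s x v w n| ≤ 1) →
        ∀ N : ℕ, ∫ z, ((N : ℝ) + 1) ^ (-(4 / 3 : ℝ)) *
          ∑ m ∈ Finset.range (Kt σ N z t), ∑ i : Fin (N + 1), ∑ j : Fin (N + 1),
            (let y := zpre σ N z m
             if hit σ N y i j then
               (if near σ N y i j then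
                 (if V < ‖(y i).2 - (y j).2‖ then 0 else
                   ‖(y i).2 - (y j).2‖ ^ 2 *
                     (ψ N (tcol σ N z m) (xmid N y i j) (y i).2 (y j).2
                         ((ε σ N)⁻¹ • G.sepVec (y i).1 (y j).1) -
                       admissibleCosineMean (adm σ N y i j) ((y i).2 - (y j).2)
                         (ψ N (tcol σ N z m) (xmid N y i j) (y i).2 (y j).2)))
                else 0)
             else 0) ∂(Q N) = 0 := by
  intro Cfg G ε τ S zpre Kt hit tcol xmid near adm θe hθe
  have hP := integral_hitSum_eq_zero_of_fibre hC
  dsimp (config := { zeta := true }) only at hP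
  obtain ⟨σ₀, hσ₀, hP⟩ := hP θe hθe
  refine ⟨min σ₀ (1 / 2), lt_min hσ₀ (by norm_num), fun σ hσ hσlt Φ => ?_⟩
  intro Q t ht V hV ψ hψm hψb N
  have hεh : hsDiameter σ N < 1 / 2 :=
    (hsDiameter_le hσ.le N).trans_lt (hσlt.trans_le (min_le_right _ _))
  -- `|ψ − admissibleCosineMean| ≤ 2`
  have hd : ∀ (a : ℝ) (x : T3) (v w n₀ : V3) (A : Set V3) (g : V3),
      |ψ N a x v w n₀ - admissibleCosineMean A g (ψ N a x v w)| ≤ 2 := fun a x v w n₀ A g =>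
    (abs_sub _ _).trans (by
      linarith [hψb N a x v w n₀, NearField.abs_admissibleCosineMean_le_one A g fun m => hψb N a x v w m])
  rw [integral_const_mul]
  refine mul_eq_zero_of_right _ (hP σ hσ (hσlt.trans_le (min_le_left _ _)) Φ t ht N (fun s y i j =>
    if near σ N y i j then
      (if V < ‖(y i).2 - (y j).2‖ then 0 else
        ‖(y i).2 - (y j).2‖ ^ 2 * (ψ N s (xmid N y i j) (y i).2 (y j).2 ((ε σ N)⁻¹ • G.sepVec (y i).1 (y j).1) -
          admissibleCosineMean (adm σ N y i j) ((y i).2 - (y j).2) (ψ N s (xmid N y i j) (y i).2 (y j).2)))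
    else 0)
    (fun i j => ?_) ⟨2 * V ^ 2, fun s y i j => ?_⟩ fun s i j hij z => ?_)
  · -- joint measurability in `(s, y)` (NearField kit, `y := Prod.snd`, `s := Prod.fst`)
    have hy : Measurable fun p : ℝ × Cfg N => p.2 := measurable_snd
    have hvi := NearField.measurable_vel' hy i
    have hvj := NearField.measurable_vel' hy j
    have hxm := NearField.measurable_xmid' hy i j
    have hg := hvi.fun_sub hvj
    refine Measurable.ite (NearField.measurableSet_nearBall _ hy i j)
      (Measurable.ite (measurableSet_lt measurable_const hg.norm) measurable_const
        ((hg.norm.pow_const 2).fun_mul ((NearField.measurable_psiAt (hψm N) measurable_fst hxm hvi hvj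
          ((NearField.measurable_sepVec' hy i j).fun_const_smul (ε σ N)⁻¹)).fun_sub
          (NearField.measurable_admissibleCosineMeanBall (ε σ N) hy i j hxm hg
            (NearField.measurable_psiAt (hψm N) (measurable_fst.comp measurable_fst) (hxm.comp measurable_fst)
              (hvi.comp measurable_fst) (hvj.comp measurable_fst) measurable_snd)))))
      measurable_const
  · -- the bound `2V²`
    exact EqCentring.abs_ite_ite_cap_le (norm_nonneg _) (fun h => not_lt.1 h) (hd _ _ _ _ _ _ _)
  · -- the fibre hypothesis
    exact stub_fibreAdmissible (hsDiameter_pos hσ N) hεh hij θe s V (ψ N) (hψm N) (hψb N) z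

end Summit.AtomisticToContinuum.HydrodynamicLimit.Theorems.ContactAngleEquidistributionSketch

end
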